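import Literature.NumberTheory.EllipticCurves.IwasawaSelmerControlCokerProofs
import Literature.NumberTheory.GaloisRepresentations.AbsGaloisGroupCompact
import HarnessLib

/-!
# Inflation–restriction with trivial invariants: a class of `H¹(H, M)` fixed by `conj_g` for all `g ∈ H'`
# comes from `H¹(H', M)` when `M^H = 0` (helper for crux `AnticyclotomicEisensteinDivisibility`,
# stmt-BirchSwinnertonDyer-20727, line `bdpline`, stub `stub_torsionSS`; general part)

Width seat bsd-line-sbc-p1-w2 gen 2 (2026-08-28). For a CLOSED normal subgroup `H ⊴ Γ_K`, any subgroup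
`H' ≥ H`, and a discrete `Γ_K`-module `M` with open stabilisers and NO non-zero `H`-fixed point, the
restriction `res : H¹(H', M) → H¹(H, M)` hits every class fixed by `conj_g` for every `g ∈ H'`
(`mem_range_resOfLe_of_forall_conjH1_eq`). This is the degenerate case `A^H = 0` of the
inflation–restriction sequence `0 → H¹(H'/H, A^H) → H¹(H', A) → H¹(H, A)^{H'/H} → H²(H'/H, A^H)`
(Serre, *Galois Cohomology* I.§2.6 (b)): BOTH outer terms vanish for the trivial reason `A^H = 0`, so
`res` is an isomorphism onto the invariants (injectivity is the tree's
`resOfLe_injective_of_forall_fixed_eq_zero`, `TwoVariableAnticyclotomicControl` §3). No `cd_p = 1` is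
involved (contrast Greenberg's Lemma 3.2, `ZpExtension.mem_range_resOfLe_of_conjH1_eq`, where `A^H ≠ 0`
and the quotient must be `ℤ_p`).

Proof, on continuous cocycles (the tree has no `H²`/transgression): for a cocycle `c` on `H` whose
class is `H'`-invariant, the element `m_g ∈ M` with `g·c(g⁻¹τg) − c(τ) = τ·m_g − m_g` (`τ ∈ H`) is
UNIQUE (`M^H = 0`, `eq_of_forall_smul_sub_eq`); hence `g ↦ m_g` is a crossed homomorphism on `H'`
(`smul_apply_subgroupConj_mul_sub`) extending `c` (`m_τ = c(τ)`, `smul_apply_subgroupConj_sub_of_mem`),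
and it is LOCALLY CONSTANT because `m_g = 0` on an open normal `V ⊴ Γ_K` fixing the finitely many values
of `c` and meeting `H` in the zero set of `c` — for such `g`, `g·c(g⁻¹τg) = c(τ)` on the nose
(`exists_openNormalSubgroup_smul_apply_subgroupConj_eq`; profiniteness of `Γ_K`). Sequel
`…ControlCoker.lean`: the `ℤ_p²`-tower `pairKer κ₁ κ₂ ≤ ker κ₂` and `M = E[p^∞]`. Honest framing: pure
Galois-cohomological bookkeeping; nothing about BSD, main conjectures or Selmer groups is asserted here.

References: J.-P. Serre, *Galois Cohomology* (1997), I.§2.6 (b); J.-P. Serre, *Local Fields*, VII.§5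
Prop. 3; Neukirch–Schmidt–Wingberg, *Cohomology of Number Fields*, (1.6.3) and I.§5; C. Skinner,
E. Urban, Invent. Math. 195 (2014), Prop. 3.2.8 (p. 23).
-/

-- D-0017: single-problem summit, the namespace repeats the problem name by design.
set_option linter.dupNamespace false
set_option autoImplicit false

noncomputable section

open scoped Classical

open Literature.NumberTheory.EllipticCurves Literature.NumberTheory.GaloisRepresentations

universe u

namespace Summit.BirchSwinnertonDyer.BirchSwinnertonDyer.Theorems.SignedBaseChangeAcDivControlCoker

/-! ## §1 Extension of an `H'`-invariant cocycle from a closed normal `H` with `M^H = 0` -/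

section General

variable {K : Type u} [Field K]
  {M : Type u} [AddCommGroup M] [DistribMulAction (Field.absoluteGaloisGroup K) M]
  [TopologicalSpace M] [DiscreteTopology M]
  {H : Subgroup (Field.absoluteGaloisGroup K)} [H.Normal]

/-- For `τ ∈ H` the twisted difference `τ·c(τ⁻¹στ) − c(σ)` is the coboundary of `c(τ)`:
`= σ·c(τ) − c(τ)` (the cocycle identity on `τ⁻¹στ = τ⁻¹·σ·τ` and `τ·c(τ⁻¹) = −c(τ)`).
Serre, *Local Fields* VII.§5 Prop. 3 (inner automorphisms). [folklore] -/
theorem smul_apply_subgroupConj_sub_of_mem (c : contOneCocycles (discreteTopRep H M)) (τ σ : H) :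
    (τ : Field.absoluteGaloisGroup K) • c.1 (subgroupConj H (τ : Field.absoluteGaloisGroup K) σ) - c.1 σ =
      (σ : Field.absoluteGaloisGroup K) • c.1 τ - c.1 τ := by
  have hconj : subgroupConj H (τ : Field.absoluteGaloisGroup K) σ = τ⁻¹ * σ * τ :=
    Subtype.ext (by simp only [subgroupConj_apply_coe, Subgroup.coe_mul, Subgroup.coe_inv])
  have hinv : c.1 τ⁻¹ = -((τ : Field.absoluteGaloisGroup K)⁻¹ • c.1 τ) := by
    have h := LayerCocycle.cocycle_mul H c τ⁻¹ τ
    rw [inv_mul_cancel, contOneCocycles.apply_one, Subgroup.coe_inv] at h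
    exact eq_neg_of_add_eq_zero_left h.symm
  rw [hconj, LayerCocycle.cocycle_mul, LayerCocycle.cocycle_mul, hinv, Subgroup.coe_mul,
    Subgroup.coe_inv]
  simp only [smul_add, smul_neg, smul_smul, mul_inv_cancel, mul_inv_cancel_left, one_smul]
  abel

omit [TopologicalSpace M] [DiscreteTopology M] [H.Normal] in
/-- Uniqueness of the element `m` with `∂m = (prescribed)` on `H` when `M^H = 0`. [folklore] -/
theorem eq_of_forall_smul_sub_eq (h0 : ∀ m : M, (∀ τ ∈ H, τ • m = m) → m = 0) {m m' : M}
    (h : ∀ σ : H, (σ : Field.absoluteGaloisGroup K) • m - m = (σ : Field.absoluteGaloisGroup K) • m' - m') :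
    m = m' := by
  rw [← sub_eq_zero]
  refine h0 _ fun τ hτ ↦ ?_
  have e := h ⟨τ, hτ⟩
  rw [sub_eq_sub_iff_sub_eq_sub] at e
  rw [smul_sub, e]

/-- **Multiplicativity of the twisted differences.** If `g·c(g⁻¹σg) − c(σ) = σ·m − m` and
`k·c(k⁻¹σk) − c(σ) = σ·n − n` on `H`, then `(gk)·c((gk)⁻¹σ(gk)) − c(σ) = σ·(m + g·n) − (m + g·n)`:
the function `g ↦ m_g` is a crossed homomorphism wherever it is defined. Neukirch–Schmidt–Wingberg I.§5
(conjugation on cochains). [folklore] -/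
theorem smul_apply_subgroupConj_mul_sub (c : contOneCocycles (discreteTopRep H M))
    {g k : Field.absoluteGaloisGroup K} {m n : M}
    (hg : ∀ σ : H, g • c.1 (subgroupConj H g σ) - c.1 σ = (σ : Field.absoluteGaloisGroup K) • m - m)
    (hk : ∀ σ : H, k • c.1 (subgroupConj H k σ) - c.1 σ = (σ : Field.absoluteGaloisGroup K) • n - n)
    (σ : H) :
    (g * k) • c.1 (subgroupConj H (g * k) σ) - c.1 σ =
      (σ : Field.absoluteGaloisGroup K) • (m + g • n) - (m + g • n) := by
  have hcomp : subgroupConj H (g * k) σ = subgroupConj H k (subgroupConj H g σ) := by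
    rw [← subgroupConj_comp]
    rfl
  have h1 : k • c.1 (subgroupConj H k (subgroupConj H g σ)) =
      c.1 (subgroupConj H g σ) + (((subgroupConj H g σ : H) : Field.absoluteGaloisGroup K) • n - n) :=
    sub_eq_iff_eq_add'.mp (hk (subgroupConj H g σ))
  have h2 : g • c.1 (subgroupConj H g σ) = c.1 σ + ((σ : Field.absoluteGaloisGroup K) • m - m) :=
    sub_eq_iff_eq_add'.mp (hg σ)
  have h3 : g • (((subgroupConj H g σ : H) : Field.absoluteGaloisGroup K) • n) =
      (σ : Field.absoluteGaloisGroup K) • (g • n) := by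
    rw [subgroupConj_apply_coe, smul_smul, smul_smul, mul_assoc, mul_inv_cancel_left]
  rw [hcomp, mul_smul, h1, smul_add, smul_sub, h2, h3, smul_add]
  abel

/-- **A small open normal subgroup for a cocycle on a closed normal `H`.** There is an open normal
`V ⊴ Γ_K` fixing every value of the continuous cocycle `c : H → M` (finitely many, `H` being compact)
and meeting `H` inside the zero set of `c` (profiniteness of `Γ_K`:
`ProfiniteGrp.exist_openNormalSubgroup_sub_open_nhds_of_one`); for such `g ∈ V` conjugation is trivial
ON THE COCYCLE: `g·c(g⁻¹τg) = c(τ)`, because `g⁻¹τg = τ·(τ⁻¹g⁻¹τg)` with `τ⁻¹g⁻¹τg ∈ V ∩ H`.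
(The argument of `TwoVariableSelmer.exists_openNormalSubgroup_conjH1_pair_eq` /
`IwasawaDual.conjH1_oneCocycleClass_eq`, with the cocycle-level conclusion exposed.)
Serre, *Galois Cohomology* I.§1.1, I.§2.2. [folklore] -/
theorem exists_openNormalSubgroup_smul_apply_subgroupConj_eq
    (hH : IsClosed (H : Set (Field.absoluteGaloisGroup K)))
    (hstab : ∀ m : M, IsOpen (MulAction.stabilizer (Field.absoluteGaloisGroup K) m :
      Set (Field.absoluteGaloisGroup K)))
    (c : contOneCocycles (discreteTopRep H M)) :
    ∃ V : OpenNormalSubgroup (Field.absoluteGaloisGroup K),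
      ∀ g ∈ V, ∀ τ : H, g • c.1 (subgroupConj H g τ) = c.1 τ := by
  haveI : CompactSpace (Field.absoluteGaloisGroup K) := absoluteGaloisGroup_compactSpace K
  haveI : CompactSpace H := isCompact_iff_compactSpace.mp hH.isCompact
  have hfin : (Set.range c.1).Finite := (isCompact_range c.1.continuous).finite_of_discrete
  set Ufix : Set (Field.absoluteGaloisGroup K) := {τ | ∀ m ∈ Set.range c.1, τ • m = m} with hUfix_def
  have hUfix : IsOpen Ufix := by
    have e : Ufix = ⋂ m ∈ Set.range c.1,
        (MulAction.stabilizer (Field.absoluteGaloisGroup K) m : Set (Field.absoluteGaloisGroup K)) := by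
      ext τ
      simp only [hUfix_def, Set.mem_setOf_eq, Set.mem_iInter, SetLike.mem_coe,
        MulAction.mem_stabilizer_iff]
    rw [e]
    exact hfin.isOpen_biInter fun m _ ↦ hstab m
  obtain ⟨U0, hU0, hU0eq⟩ := isOpen_induced_iff.mp (ResKernel.isOpen_zeroSubgroup c)
  have h1fix : (1 : Field.absoluteGaloisGroup K) ∈ Ufix := fun m _ ↦ one_smul _ m
  have h1U0 : (1 : Field.absoluteGaloisGroup K) ∈ U0 := by
    have : (1 : H) ∈ Subtype.val ⁻¹' U0 := by
      rw [hU0eq]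
      exact (ResKernel.zeroSubgroup c).one_mem
    exact this
  obtain ⟨V, hV⟩ := ProfiniteGrp.exist_openNormalSubgroup_sub_open_nhds_of_one
    (hUfix.inter hU0) ⟨h1fix, h1U0⟩
  refine ⟨V, fun g hg τ ↦ ?_⟩
  -- `g⁻¹ τ g = τ · n` with `n = τ⁻¹ g⁻¹ τ g ∈ V ∩ H`
  have hn : ((τ : Field.absoluteGaloisGroup K)⁻¹ * g⁻¹ * τ * g) ∈ H := by
    have h1 : g⁻¹ * (τ : Field.absoluteGaloisGroup K) * g⁻¹⁻¹ ∈ H :=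
      Subgroup.Normal.conj_mem inferInstance _ τ.2 g⁻¹
    rw [inv_inv] at h1
    simpa only [mul_assoc] using H.mul_mem (H.inv_mem τ.2) h1
  have hnV : ((τ : Field.absoluteGaloisGroup K)⁻¹ * g⁻¹ * τ * g) ∈ (V : Set (Field.absoluteGaloisGroup K)) := by
    have h1 : (τ : Field.absoluteGaloisGroup K)⁻¹ * g⁻¹ * (τ : Field.absoluteGaloisGroup K)⁻¹⁻¹ ∈
        V.toSubgroup := Subgroup.Normal.conj_mem inferInstance _ (V.toSubgroup.inv_mem hg) _
    rw [inv_inv] at h1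
    exact V.toSubgroup.mul_mem h1 hg
  have hconj : subgroupConj H g τ = τ * ⟨_, hn⟩ := Subtype.ext (by
    simp only [subgroupConj_apply_coe, Subgroup.coe_mul, mul_assoc, mul_inv_cancel_left])
  have hzero : c.1 ⟨_, hn⟩ = 0 := by
    have h : (⟨_, hn⟩ : H) ∈ Subtype.val ⁻¹' U0 := (hV hnV).2
    rw [hU0eq] at h
    exact (ResKernel.mem_zeroSubgroup_iff c _).mp h
  rw [hconj, LayerCocycle.cocycle_mul, hzero, smul_zero, add_zero]
  exact (hV hg).1 _ ⟨τ, rfl⟩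

/-- **Extension of an `H'`-invariant cocycle when `M^H = 0`.** Let `H ⊴ Γ_K` be closed, `H ≤ H'`,
`M` a discrete `Γ_K`-module with open stabilisers and `M^H = 0`, and `c` a continuous cocycle on `H`
such that for every `g ∈ H'` the conjugate `g·c(g⁻¹·g)` differs from `c` by a coboundary `∂m_g`. Then
`c` is the restriction of a continuous cocycle `b` on `H'` (namely `b(g) = m_g`, well defined by
`eq_of_forall_smul_sub_eq`, a crossed homomorphism by `smul_apply_subgroupConj_mul_sub`, extending `c` by
`smul_apply_subgroupConj_sub_of_mem`, and vanishing on an open `V ∩ H'` by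
`exists_openNormalSubgroup_smul_apply_subgroupConj_eq`, hence locally constant). This is the exactness of
`H¹(H', M) → H¹(H, M)^{H'} → H²(H'/H, M^H) = 0` made explicit. [cite: SerreGaloisCohomology1997, I.§2.6 (b)] -/
theorem exists_cocycle_extend_of_forall_fixed_eq_zero {H' : Subgroup (Field.absoluteGaloisGroup K)}
    (hle : H ≤ H') (hH : IsClosed (H : Set (Field.absoluteGaloisGroup K)))
    (hstab : ∀ m : M, IsOpen (MulAction.stabilizer (Field.absoluteGaloisGroup K) m :
      Set (Field.absoluteGaloisGroup K)))
    (h0 : ∀ m : M, (∀ τ ∈ H, τ • m = m) → m = 0)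
    (c : contOneCocycles (discreteTopRep H M))
    (hc : ∀ g ∈ H', ∃ m : M, ∀ σ : H,
      g • c.1 (subgroupConj H g σ) - c.1 σ = (σ : Field.absoluteGaloisGroup K) • m - m) :
    ∃ b : contOneCocycles (discreteTopRep H' M),
      ∀ (τ : Field.absoluteGaloisGroup K) (hτ : τ ∈ H), b.1 ⟨τ, hle hτ⟩ = c.1 ⟨τ, hτ⟩ := by
  choose m hm using hc
  obtain ⟨V, hV⟩ := exists_openNormalSubgroup_smul_apply_subgroupConj_eq hH hstab c
  -- the function `x ↦ m_x` on `H'` and its characterisation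
  let bfun : H' → M := fun x ↦ m x x.2
  have huniq : ∀ (x : H') (m' : M), (∀ σ : H, (x : Field.absoluteGaloisGroup K) •
      c.1 (subgroupConj H (x : Field.absoluteGaloisGroup K) σ) - c.1 σ =
        (σ : Field.absoluteGaloisGroup K) • m' - m') → bfun x = m' := fun x m' h' ↦
    eq_of_forall_smul_sub_eq h0 fun σ ↦ (hm x x.2 σ).symm.trans (h' σ)
  -- on `H` it is `c`
  have hres : ∀ (τ : Field.absoluteGaloisGroup K) (hτ : τ ∈ H), bfun ⟨τ, hle hτ⟩ = c.1 ⟨τ, hτ⟩ :=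
    fun τ hτ ↦ huniq ⟨τ, hle hτ⟩ _ (smul_apply_subgroupConj_sub_of_mem c ⟨τ, hτ⟩)
  -- it vanishes on `V ∩ H'`
  have hvan : ∀ x : H', (x : Field.absoluteGaloisGroup K) ∈ V → bfun x = 0 := fun x hx ↦
    huniq x 0 fun σ ↦ by rw [hV _ hx σ, sub_self, smul_zero, sub_self]
  have hVo : IsOpen (V : Set (Field.absoluteGaloisGroup K)) := V.toOpenSubgroup.isOpen
  -- it is a crossed homomorphism
  have hmul : ∀ x y : H', bfun (x * y) = bfun x + (x : Field.absoluteGaloisGroup K) • bfun y :=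
    fun x y ↦ huniq (x * y) _ (smul_apply_subgroupConj_mul_sub c (hm x x.2) (hm y y.2))
  -- hence locally constant
  have hloc : ∀ x y : H', (x : Field.absoluteGaloisGroup K)⁻¹ * y ∈ V → bfun y = bfun x := by
    intro x y hxy
    have e : y = x * (x⁻¹ * y) := by rw [mul_inv_cancel_left]
    have hxy' : ((x⁻¹ * y : H') : Field.absoluteGaloisGroup K) ∈ V := by
      rw [Subgroup.coe_mul, Subgroup.coe_inv]
      exact hxy
    rw [e, hmul, hvan (x⁻¹ * y) hxy', smul_zero, add_zero]
  have hcontb : Continuous bfun := by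
    refine IsLocallyConstant.continuous ((IsLocallyConstant.iff_exists_open bfun).mpr fun x ↦ ?_)
    refine ⟨{y | (x : Field.absoluteGaloisGroup K)⁻¹ * y ∈ V}, ?_, ?_, fun y hy ↦ hloc x y hy⟩
    · exact hVo.preimage (continuous_const.mul continuous_subtype_val)
    · show (x : Field.absoluteGaloisGroup K)⁻¹ * x ∈ V
      rw [inv_mul_cancel]
      exact V.toSubgroup.one_mem
  exact ⟨⟨⟨bfun, hcontb⟩, fun x y ↦ hmul x y⟩, hres⟩

omit [TopologicalSpace M] [DiscreteTopology M] in
/-- The compatibility of the pair `(σ⁻¹ (·) σ, σ • ·)` defining `conjH1` (restated for rewriting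
`conjH1` on explicit cocycles). Serre, *Galois Cohomology* I.§2.5. [folklore] -/
theorem conj_compat (σ : Field.absoluteGaloisGroup K) (x : H) (v : M) :
    DistribSMul.toAddMonoidHom M σ (subgroupConj H σ x • v) = x • DistribSMul.toAddMonoidHom M σ v :=
  ZpExtension.conj_compat H σ x v

/-- **Restriction `H¹(H', M) → H¹(H, M)` hits every class fixed by `conj_g` for all `g ∈ H'`**, for
`H ⊴ Γ_K` closed, `H ≤ H'`, `M` discrete with open stabilisers and `M^H = 0`: the class-level form of
`exists_cocycle_extend_of_forall_fixed_eq_zero` (through `map_oneCocycleClass` / `oneCocycleClass_eq_zero_iff`).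
Together with the tree's `resOfLe_injective_of_forall_fixed_eq_zero` this is the isomorphism
`H¹(H', M) ≅ H¹(H, M)^{H'}` of the degenerate inflation–restriction sequence.
[cite: SerreGaloisCohomology1997, I.§2.6 (b)] [cite: SkinnerUrban2014, Prop. 3.2.8 (p. 23)] -/
theorem mem_range_resOfLe_of_forall_conjH1_eq {H' : Subgroup (Field.absoluteGaloisGroup K)}
    (hle : H ≤ H') (hH : IsClosed (H : Set (Field.absoluteGaloisGroup K)))
    (hstab : ∀ m : M, IsOpen (MulAction.stabilizer (Field.absoluteGaloisGroup K) m :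
      Set (Field.absoluteGaloisGroup K)))
    (h0 : ∀ m : M, (∀ τ ∈ H, τ • m = m) → m = 0)
    (x : subgroupH1 H M) (hx : ∀ g ∈ H', conjH1 H M g x = x) :
    x ∈ (resOfLe M hle).range := by
  obtain ⟨c, rfl⟩ := oneCocycleClass_surjective _ x
  have hc : ∀ g ∈ H', ∃ m : M, ∀ σ : H,
      g • c.1 (subgroupConj H g σ) - c.1 σ = (σ : Field.absoluteGaloisGroup K) • m - m := by
    intro g hg
    have hconj : conjH1 H M g (oneCocycleClass _ c) =
        oneCocycleClass _ (contOneCocycles.pullback (subgroupConj H g)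
          (resHomOfEquivariant (subgroupConj H g) (DistribSMul.toAddMonoidHom M g) (conj_compat g)) c) :=
      map_oneCocycleClass _ _ _ c
    have h := hx g hg
    rw [hconj, ← sub_eq_zero, ← oneCocycleClass_sub, oneCocycleClass_eq_zero_iff] at h
    obtain ⟨m, hm⟩ := h
    refine ⟨m, fun σ ↦ ?_⟩
    have h' := hm σ
    rw [Submodule.coe_sub, ContinuousMap.sub_apply, contOneCocycles.pullback_apply] at h'
    exact h'
  obtain ⟨b, hb⟩ := exists_cocycle_extend_of_forall_fixed_eq_zero hle hH hstab h0 c hc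
  refine ⟨oneCocycleClass _ b, ?_⟩
  have hres : resOfLe M hle (oneCocycleClass _ b) =
      oneCocycleClass _ (contOneCocycles.pullback (subgroupInclusion hle)
        (resHomOfEquivariant (subgroupInclusion hle) (AddMonoidHom.id M) (fun _ _ ↦ rfl)) b) :=
    map_oneCocycleClass _ _ _ b
  rw [hres]
  congr 1
  apply Subtype.ext
  ext τ
  rw [contOneCocycles.pullback_apply]
  exact hb τ τ.2

end General

end Summit.BirchSwinnertonDyer.BirchSwinnertonDyer.Theorems.SignedBaseChangeAcDivControlCoker

end
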